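import Literature.NumberTheory.Rogawski1990.EndoscopicClassTransfer
import Literature.NumberTheory.Rogawski1990.AdelicStableClassSupportFinite
import HarnessLib

/-!
# Rational elements of the quasi-split `U(Φ₂)` with PRESCRIBED σ-reciprocal characteristic polynomial, and the SURJECTION
# «every norm-one root `β` of `charpoly γ₀` is the `U(1)`-value of an `H`-class transferring to `𝒪_st(γ₀)`»
(Rogawski, *Automorphic Representations of Unitary Groups in Three Variables* (1990), §3.2 Thm. 3.2.1 (Kottwitz–Steinberg: every stable class of a
QUASI-SPLIT group has a rational representative), §3.5–§3.6 pp. 29–33 (the tori `T` of `U(3)` and `H = U(2) × U(1)`), §5.4 (5.4.5) pp. 72–74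
(«the stable classes `𝒪′_st` in `H` which transfer to `𝒪_st`»: `3 ∕ 1 ∕ 0` of them for `T` of type (1) ∕ (2) ∕ (3)))

Topic `NumberTheory/Rogawski1990`; namespace `Literature.NumberTheory.Rogawski1990`.  THEOREMS ONLY (no definition, no named fact, no instance, no
notation, no `sorry`).  Cell `pub/hodgecm-mathlib`, ENGINE T1 (crux item stmt-HodgeConjecture-24833), F0P3a-plan (g4) RULING #99 (b) row **(KS-2a)**: the
rank-2 Kottwitz–Steinberg input of the per-regular-`γ₀` package of LEAD DECISION #2 — the SURJECTION half of the (5.4.5) bijection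
`e(γ₀) : {𝒪H ↦ 𝒪_st(γ₀)} ≃ {χ ≠ 1}` (the injection half is ★ `StableClassH.injOn_sndVal_setOf_transfersTo`, `EndoscopicClassTransfer` §5).

THE WITNESS (no Landherr, no local–global principle, no case distinction irreducible ∕ split).  Let `σ` be an involution of a field `L` with `σ ≠ id`, and
`t d : L` with **`d · σ d = 1` and `t = σ t · d`** — exactly the condition that the root set of `q = X² − tX + d` is stable under `z ↦ σ(z)⁻¹`
(`q` «σ-reciprocal»; §3 shows every quotient `charpoly γ ∕ (X − β)` of the characteristic polynomial of a unitary `3 × 3` matrix by a norm-one root `β` is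
of this shape).  Pick `β ∈ Lˣ` with **`β = −d · σβ`** (quadratic Hilbert 90 made explicit: `β := 1 − d` when `d ≠ 1`, since then `−d·σ(1 − d) = −d + dσd = 1 − d`;
`β := z − σz` for any `σz ≠ z` when `d = 1`).  Then
`g := (0, −d∕β; β, t)` satisfies `ᵗ(σg) Φ₂ g = Φ₂` (`Φ₂ = antidiag(1, 1)`: the three non-trivial entries are `−dσβ∕β = 1`, `−σd·β∕σβ = dσd = 1`,
`(t − σt·d)∕β = 0`), `det g = d`, `tr g = t`, so `g ∈ U(Φ₂)(L^σ)` has characteristic polynomial `q` (Mathlib ★ `Matrix.charpoly_fin_two`).  [It is the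
companion matrix of `q` in a hyperbolic basis of the hermitian form `(u, v) ↦ Tr_{L[x]∕(q) ∕ L}(λ τ(u) v)` with `Tr λ = 0` — the proof needs none of this.]

* §1 `exists_ne_zero_eq_neg_mul_map` — the `β`.
* §2 **`exists_unitaryGroup_antidiagTwo_charpoly_eq (hσσ) (hσ : ∃ z, σ z ≠ z) (hd : d * σ d = 1) (ht : t = σ t * d) :
  ∃ g : unitaryGroup σ Φ₂, charpoly g = X ^ 2 − C t * X + C d`** [Rogawski1990, Thm. 3.2.1 for `U(Φ₂)`].
* §3 unitary elements: `det γ · σ(det γ) = 1`, `tr γ⁻¹ = σ(tr γ)`, `σ(tr γ) · det γ = (charpoly γ).coeff 1` (`3 × 3`, via Mathlib ★ `Matrix.charpoly_inv` ∕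
  `reverse_charpoly`); hence for a root `β` of `charpoly γ` with `β σβ = 1` the monic quotient `charpoly γ ∕ₘ (X − C β) = X² − C t * X + C d` has
  `d σ d = 1` and `t = σ t · d` (**`divByMonic_X_sub_C_eq_of_isRoot_of_mul_map_eq_one`**).
* §4 **`exists_unitaryGroup_antidiagTwo_charpoly_mul_X_sub_C_eq`** — `∃ γ₂ ∈ U(Φ₂)(L^σ), charpoly γ₂ · (X − β) = charpoly γ` — and the SURJECTION
  **`exists_stableClassH_transfersTo_and_sndVal_eq (hreg : IsRegularElt γ) (hβ : IsRoot (charpoly γ) β) (hβ1 : β * σ β = 1) :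
  ∃ 𝒪H : StableClassH σ Φ₂ Φ₁, 𝒪H.TransfersTo H endoForm_antidiagOne (stableClassOf σ H γ) ∧ 𝒪H.sndVal = β`** (★ `charpoly_endoEmb`, ★
  `isConj_of_charpoly_eq_of_separable`, ★ `StableClassH.transfersTo_mk_iff`), for EVERY hermitian target `H ∈ M₃(L)` (the inner form `U(H)` or `U(Φ₃)` itself);
  §5 the CM dress (`σ = cmConjRingHom L`, `σ ≠ id` automatic).
HONEST LABEL: HC_CM is proved only modulo the printed citations until rung 0 closes; this file is unconditional.

## References
* [Rogawski1990] J. D. Rogawski, *Automorphic Representations of Unitary Groups in Three Variables*, Ann. of Math. Stud. 123 (1990), §3.2 Thm. 3.2.1 p. 20,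
  §3.5–§3.6 pp. 29–33, §5.4 (5.4.5) pp. 72–74.
* [Kottwitz1982] R. E. Kottwitz, *Rational conjugacy classes in reductive groups*, Duke Math. J. 49 (1982), Thm. 4.4, §6 (print source of Thm. 3.2.1; not used).
-/

set_option autoImplicit false

noncomputable section

open Polynomial Matrix
open scoped MatrixGroups

namespace Literature.NumberTheory.Rogawski1990

open Literature.AlgebraicGeometry.ShimuraVarieties (unitaryGroup)

/-! ## §1 Quadratic Hilbert 90, explicit: `β ≠ 0` with `β = −d · σβ` whenever `d · σd = 1` -/

section HilbertNinety

variable {L : Type*} [Field L] (σ : L →+* L)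

/-- **`β = −d·σβ` has a non-zero solution** when `d σd = 1` and `σ` is a non-trivial involution: `β := 1 − d` if `d ≠ 1` (then `−d·σ(1 − d) = −d + d σd = 1 − d`),
`β := z − σ z` for any `σ z ≠ z` if `d = 1`. [cite: Rogawski1990, §3.2 Thm. 3.2.1 p. 20] -/
theorem exists_ne_zero_eq_neg_mul_map (hσσ : ∀ x, σ (σ x) = x) (hσ : ∃ z, σ z ≠ z) {d : L} (hd : d * σ d = 1) :
    ∃ β : L, β ≠ 0 ∧ β = -d * σ β := by
  by_cases h1 : d = 1
  · obtain ⟨z, hz⟩ := hσ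
    refine ⟨z - σ z, sub_ne_zero.2 (Ne.symm hz), ?_⟩
    rw [h1, map_sub, hσσ]
    ring
  · refine ⟨1 - d, sub_ne_zero.2 (Ne.symm h1), ?_⟩
    rw [map_sub, map_one]
    linear_combination -hd

end HilbertNinety

/-! ## §2 The witness in `U(Φ₂)` with characteristic polynomial `X² − tX + d` -/

section Witness

variable {L : Type*} [Field L] (σ : L →+* L)

/-- Entrywise `map` of a `2 × 2` matrix literal. [folklore] -/
private theorem map_fin_two (f : L →+* L) (a b c e : L) : (!![a, b; c, e] : Matrix (Fin 2) (Fin 2) L).map f = !![f a, f b; f c, f e] := by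
  ext i j; fin_cases i <;> fin_cases j <;> rfl

/-- The split form `Φ₂ = antidiag(1, 1)` of this topic as a matrix literal. [cite: Rogawski1990, §3.5 p. 29] -/
theorem antidiagTwo_eq : (Matrix.of fun i j : Fin 2 => if i.val + j.val + 1 = 2 then (1 : L) else 0) = !![0, 1; 1, 0] := by
  ext i j; fin_cases i <;> fin_cases j <;> rfl

/-- **Kottwitz–Steinberg for the quasi-split `U(Φ₂)`, explicit**: for a non-trivial involution `σ` of the field `L` and `t d : L` with `d σd = 1`, `t = σt · d`
(⟺ `X² − tX + d` is σ-reciprocal), there is `g ∈ U(Φ₂)(L^σ) = {g : ᵗ(σg) Φ₂ g = Φ₂}` with `charpoly g = X² − tX + d` — namely `g = (0, −d∕β; β, t)` for any `β ≠ 0`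
with `β = −d σβ` (§1). [cite: Rogawski1990, §3.2 Thm. 3.2.1 p. 20] [cite: Rogawski1990, §3.5 Prop. 3.5.2 p. 29] -/
theorem exists_unitaryGroup_antidiagTwo_charpoly_eq (hσσ : ∀ x, σ (σ x) = x) (hσ : ∃ z, σ z ≠ z) {t d : L} (hd : d * σ d = 1) (ht : t = σ t * d) :
    ∃ g : unitaryGroup σ (Matrix.of fun i j : Fin 2 => if i.val + j.val + 1 = 2 then (1 : L) else 0),
      ((g : GL (Fin 2) L) : Matrix (Fin 2) (Fin 2) L).charpoly = X ^ 2 - C t * X + C d := by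
  obtain ⟨β, hβ0, hβ⟩ := exists_ne_zero_eq_neg_mul_map σ hσσ hσ hd
  have hd0 : d ≠ 0 := left_ne_zero_of_mul_eq_one hd
  have hσd0 : σ d ≠ 0 := right_ne_zero_of_mul_eq_one hd
  -- `σβ = −σd · β`
  have hσβ : σ β = -σ d * β := by
    have h := congrArg σ hβ
    rw [map_mul, map_neg, hσσ] at h
    exact h
  -- the witness `g = (0, a; β, t)`, `a = −d∕β`
  set a : L := -d * β⁻¹ with ha_def
  have hσa : σ a = β⁻¹ := by
    rw [ha_def, map_mul, map_neg, map_inv₀, hσβ]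
    field_simp
  have h12 : σ β * a = 1 := by
    rw [hσβ, ha_def]
    field_simp
    linear_combination hd
  have h21 : σ a * β = 1 := by rw [hσa, inv_mul_cancel₀ hβ0]
  have h22 : σ a * t + σ t * a = 0 := by
    rw [hσa, ha_def]
    field_simp
    linear_combination ht
  have hdet : (!![0, a; β, t] : Matrix (Fin 2) (Fin 2) L).det = d := by
    rw [Matrix.det_fin_two_of, ha_def]
    field_simp
    ring
  have hdet0 : (!![0, a; β, t] : Matrix (Fin 2) (Fin 2) L).det ≠ 0 := by rw [hdet]; exact hd0
  refine ⟨⟨Matrix.GeneralLinearGroup.mkOfDetNeZero _ hdet0, ?_⟩, ?_⟩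
  · -- unitarity: `ᵗ(σg) Φ₂ g = Φ₂`
    change (((Matrix.GeneralLinearGroup.mkOfDetNeZero _ hdet0 : GL (Fin 2) L) : Matrix (Fin 2) (Fin 2) L).map σ)ᵀ *
        (Matrix.of fun i j : Fin 2 => if i.val + j.val + 1 = 2 then (1 : L) else 0) *
        ((Matrix.GeneralLinearGroup.mkOfDetNeZero _ hdet0 : GL (Fin 2) L) : Matrix (Fin 2) (Fin 2) L) =
      Matrix.of fun i j : Fin 2 => if i.val + j.val + 1 = 2 then (1 : L) else 0
    rw [antidiagTwo_eq]
    change ((!![0, a; β, t] : Matrix (Fin 2) (Fin 2) L).map σ)ᵀ * !![0, 1; 1, 0] * !![0, a; β, t] = !![0, 1; 1, 0]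
    rw [map_fin_two, map_zero]
    ext i j
    fin_cases i <;> fin_cases j
    · simp [Matrix.mul_apply, Fin.sum_univ_two]
    · simp [Matrix.mul_apply, Fin.sum_univ_two]
      linear_combination h12
    · simp [Matrix.mul_apply, Fin.sum_univ_two]
      linear_combination h21
    · simp [Matrix.mul_apply, Fin.sum_univ_two]
      linear_combination h22
  · -- characteristic polynomial (★ `charpoly_fin_two`)
    change (!![0, a; β, t] : Matrix (Fin 2) (Fin 2) L).charpoly = X ^ 2 - C t * X + C d
    rw [Matrix.charpoly_fin_two, Matrix.trace_fin_two_of, hdet, zero_add]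

end Witness

/-! ## §3 Unitary `3 × 3` matrices: `det γ · σ(det γ) = 1`, `tr γ⁻¹ = σ(tr γ)`, and σ-reciprocity of the quotient by a norm-one root -/

section Unitary

variable {L : Type*} [Field L] {σ : L →+* L} {H : Matrix (Fin 3) (Fin 3) L}

/-- Coefficients of a monic cubic written out. [folklore] -/
private theorem coeff_cubic {L : Type*} [Field L] (a b c : L) :
    (X ^ 3 - C a * X ^ 2 + C b * X - C c : L[X]).coeff 0 = -c ∧ (X ^ 3 - C a * X ^ 2 + C b * X - C c : L[X]).coeff 1 = b ∧
      (X ^ 3 - C a * X ^ 2 + C b * X - C c : L[X]).coeff 2 = -a := by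
  refine ⟨?_, ?_, ?_⟩ <;> simp [Polynomial.coeff_X, Polynomial.coeff_C, Polynomial.coeff_X_pow]

/-- **`det γ · σ(det γ) = 1`** for `γ ∈ U(σ, H)(L)` (`det H ≠ 0`): the determinant of `ᵗ(σγ) H γ = H`. [cite: Rogawski1990, §3.1 p. 19] -/
theorem det_mul_map_det_eq_one_of_mem_unitaryGroup (hH : H.det ≠ 0) (γ : unitaryGroup σ H) :
    ((γ : GL (Fin 3) L) : Matrix (Fin 3) (Fin 3) L).det * σ ((γ : GL (Fin 3) L) : Matrix (Fin 3) (Fin 3) L).det = 1 := by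
  have hγ := (Literature.AlgebraicGeometry.ShimuraVarieties.mem_unitaryGroup_iff).1 γ.2
  have h := congrArg Matrix.det hγ
  rw [Matrix.det_mul, Matrix.det_mul, Matrix.det_transpose, ← RingHom.mapMatrix_apply, ← RingHom.map_det] at h
  -- `σ(det γ) · det H · det γ = det H`
  have h' : (σ ((γ : GL (Fin 3) L) : Matrix (Fin 3) (Fin 3) L).det * ((γ : GL (Fin 3) L) : Matrix (Fin 3) (Fin 3) L).det) * H.det = 1 * H.det := by
    rw [one_mul]; linear_combination h
  have := mul_right_cancel₀ hH h'
  rw [mul_comm] at this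
  exact this

/-- **`γ⁻¹ = H⁻¹ ᵗ(σγ) H`** for `γ ∈ U(σ, H)(L)` (`det H ≠ 0`). [cite: Rogawski1990, §3.1 p. 19] -/
theorem coe_inv_eq_of_mem_unitaryGroup (hH : H.det ≠ 0) (γ : unitaryGroup σ H) :
    ((γ : GL (Fin 3) L) : Matrix (Fin 3) (Fin 3) L)⁻¹ = H⁻¹ * (((γ : GL (Fin 3) L) : Matrix (Fin 3) (Fin 3) L).map σ)ᵀ * H := by
  have hγ := (Literature.AlgebraicGeometry.ShimuraVarieties.mem_unitaryGroup_iff).1 γ.2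
  have hHu : IsUnit H.det := isUnit_iff_ne_zero.2 hH
  refine Matrix.inv_eq_left_inv ?_
  calc H⁻¹ * (((γ : GL (Fin 3) L) : Matrix (Fin 3) (Fin 3) L).map σ)ᵀ * H * ((γ : GL (Fin 3) L) : Matrix (Fin 3) (Fin 3) L)
      = H⁻¹ * ((((γ : GL (Fin 3) L) : Matrix (Fin 3) (Fin 3) L).map σ)ᵀ * H * ((γ : GL (Fin 3) L) : Matrix (Fin 3) (Fin 3) L)) := by
        simp only [Matrix.mul_assoc]
    _ = 1 := by rw [hγ, Matrix.nonsing_inv_mul _ hHu]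

/-- **`tr γ⁻¹ = σ(tr γ)`** for `γ ∈ U(σ, H)(L)`: `γ⁻¹ = H⁻¹ ᵗ(σγ) H` is conjugate to `ᵗ(σγ)`. [cite: Rogawski1990, §3.1 p. 19] -/
theorem trace_inv_eq_map_trace_of_mem_unitaryGroup (hH : H.det ≠ 0) (γ : unitaryGroup σ H) :
    (((γ : GL (Fin 3) L) : Matrix (Fin 3) (Fin 3) L)⁻¹).trace = σ ((γ : GL (Fin 3) L) : Matrix (Fin 3) (Fin 3) L).trace := by
  have hHu : IsUnit H.det := isUnit_iff_ne_zero.2 hH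
  rw [coe_inv_eq_of_mem_unitaryGroup hH γ, Matrix.mul_assoc, Matrix.trace_mul_comm, Matrix.mul_assoc, Matrix.mul_nonsing_inv _ hHu,
    Matrix.mul_one, Matrix.trace_transpose]
  simp only [Matrix.trace, Matrix.diag_apply, Matrix.map_apply, map_sum]

/-- **`σ(tr γ) · det γ = (charpoly γ)₁`** (the `X`-coefficient) for `γ ∈ U(σ, H)(L)`: `tr γ⁻¹ = (charpoly γ)₁ ∕ det γ` for any invertible `3 × 3` matrix
(Mathlib ★ `Matrix.charpoly_inv`, `reverse_charpoly`), and `tr γ⁻¹ = σ(tr γ)`. [cite: Rogawski1990, §3.1 p. 19] -/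
theorem map_trace_mul_det_eq_coeff_one_of_mem_unitaryGroup (hH : H.det ≠ 0) (γ : unitaryGroup σ H) :
    σ ((γ : GL (Fin 3) L) : Matrix (Fin 3) (Fin 3) L).trace * ((γ : GL (Fin 3) L) : Matrix (Fin 3) (Fin 3) L).det =
      (((γ : GL (Fin 3) L) : Matrix (Fin 3) (Fin 3) L).charpoly).coeff 1 := by
  set M : Matrix (Fin 3) (Fin 3) L := ((γ : GL (Fin 3) L) : Matrix (Fin 3) (Fin 3) L) with hM
  have hdet0 : M.det ≠ 0 := left_ne_zero_of_mul_eq_one (det_mul_map_det_eq_one_of_mem_unitaryGroup hH γ)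
  have hMu : IsUnit M := (Matrix.isUnit_iff_isUnit_det M).2 (isUnit_iff_ne_zero.2 hdet0)
  -- `tr M⁻¹ = −(charpoly M⁻¹)₂ = −(−det⁻¹ · (charpoly M)₁)`
  have h1 : M⁻¹.trace = -(M⁻¹.charpoly).coeff (Fintype.card (Fin 3) - 1) := Matrix.trace_eq_neg_charpoly_coeff M⁻¹
  have h2 : (M⁻¹.charpoly).coeff 2 = -(M.det⁻¹ * M.charpoly.coeff 1) := by
    rw [Matrix.charpoly_inv M hMu, ← Matrix.reverse_charpoly, Ring.inverse_eq_inv', Fintype.card_fin]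
    rw [show ((-1 : L[X]) ^ 3) = -1 by norm_num, neg_one_mul, neg_mul, Polynomial.coeff_neg, Polynomial.coeff_C_mul, Polynomial.coeff_reverse,
      Matrix.charpoly_natDegree_eq_dim, Fintype.card_fin, Polynomial.revAt_le (by norm_num : 2 ≤ 3)]
  rw [Fintype.card_fin, show 3 - 1 = 2 from rfl, h2, neg_neg] at h1
  rw [← trace_inv_eq_map_trace_of_mem_unitaryGroup hH γ, ← hM, h1, mul_comm, ← mul_assoc, mul_inv_cancel₀ hdet0, one_mul]

/-- **σ-RECIPROCITY OF THE QUOTIENT**: for `γ ∈ U(σ, H)(L)` (`3 × 3`, `det H ≠ 0`) and a root `β ∈ L` of `charpoly γ` with `β σβ = 1`, the quotient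
`charpoly γ ∕ (X − β) = X² − tX + d` has `d σd = 1` and `t = σt · d` — its roots are again stable under `z ↦ σ(z)⁻¹`.  (Coefficients: `det γ = βd`,
`tr γ = t + β`, `(charpoly γ)₁ = d + βt`; then `det γ · σ(det γ) = 1` and `σ(tr γ) det γ = (charpoly γ)₁`.) [cite: Rogawski1990, §3.5–§3.6 pp. 29–33] -/
theorem exists_charpoly_eq_X_sub_C_mul_of_isRoot (hH : H.det ≠ 0) (γ : unitaryGroup σ H) {β : L}
    (hβ : (((γ : GL (Fin 3) L) : Matrix (Fin 3) (Fin 3) L).charpoly).IsRoot β) (hβ1 : β * σ β = 1) :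
    ∃ t d : L, d * σ d = 1 ∧ t = σ t * d ∧
      ((γ : GL (Fin 3) L) : Matrix (Fin 3) (Fin 3) L).charpoly = (X - C β) * (X ^ 2 - C t * X + C d) := by
  set M : Matrix (Fin 3) (Fin 3) L := ((γ : GL (Fin 3) L) : Matrix (Fin 3) (Fin 3) L) with hM
  set p : L[X] := M.charpoly with hp
  have hβ0 : β ≠ 0 := left_ne_zero_of_mul_eq_one hβ1
  -- the monic quadratic quotient
  set q : L[X] := p /ₘ (X - C β) with hq
  have hpq : (X - C β) * q = p := (Polynomial.mul_divByMonic_eq_iff_isRoot).2 hβ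
  have hpdeg : p.natDegree = 3 := by rw [hp, Matrix.charpoly_natDegree_eq_dim, Fintype.card_fin]
  have hqdeg : q.natDegree = 2 := by
    rw [hq, Polynomial.natDegree_divByMonic p (Polynomial.monic_X_sub_C β), hpdeg, Polynomial.natDegree_X_sub_C]
  have hqlc : q.leadingCoeff = 1 := by
    have h := congrArg Polynomial.leadingCoeff hpq
    rw [Polynomial.leadingCoeff_mul, Polynomial.leadingCoeff_X_sub_C, one_mul] at h
    rw [h]; exact Matrix.charpoly_monic M
  set t : L := -q.coeff 1 with ht
  set d : L := q.coeff 0 with hd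
  have hqe : q = X ^ 2 - C t * X + C d := by
    ext n
    rcases n with _ | _ | _ | n
    · simp [hd]
    · simp [ht]
    · have : q.coeff 2 = 1 := by rw [← hqdeg]; exact hqlc
      simp [this]
    · have hz : q.coeff (n + 3) = 0 := Polynomial.coeff_eq_zero_of_natDegree_lt (by rw [hqdeg]; omega)
      rw [hz]
      simp [Polynomial.coeff_X_pow]
  -- the coefficients of `p = (X − β)(X² − tX + d)`
  have hexp : p = X ^ 3 - C (t + β) * X ^ 2 + C (d + β * t) * X - C (β * d) := by
    rw [← hpq, hqe]; simp only [map_add, map_mul]; ring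
  have hc0 : p.coeff 0 = -(β * d) := by rw [hexp]; exact (coeff_cubic (t + β) (d + β * t) (β * d)).1
  have hc1 : p.coeff 1 = d + β * t := by rw [hexp]; exact (coeff_cubic (t + β) (d + β * t) (β * d)).2.1
  have hc2 : p.coeff 2 = -(t + β) := by rw [hexp]; exact (coeff_cubic (t + β) (d + β * t) (β * d)).2.2
  -- `det γ = βd`, `tr γ = t + β`
  have hdet : M.det = β * d := by
    rw [Matrix.det_eq_sign_charpoly_coeff, Fintype.card_fin, ← hp, hc0]; ring
  have htr : M.trace = t + β := by
    rw [Matrix.trace_eq_neg_charpoly_coeff, Fintype.card_fin, ← hp, show 3 - 1 = 2 from rfl, hc2, neg_neg]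
  -- the two unitary identities
  have hU1 := det_mul_map_det_eq_one_of_mem_unitaryGroup hH γ
  have hU3 := map_trace_mul_det_eq_coeff_one_of_mem_unitaryGroup hH γ
  rw [← hM] at hU1 hU3
  rw [hdet, map_mul] at hU1
  rw [htr, hdet, ← hp, hc1, map_add] at hU3
  have hσββ : σ β * β = 1 := by rw [mul_comm]; exact hβ1
  -- `d σd = 1`
  have hdd : d * σ d = 1 := by linear_combination hU1 - (d * σ d) * hβ1
  refine ⟨t, d, hdd, ?_, ?_⟩
  swap
  · change p = _
    rw [hexp]; simp only [map_add, map_mul]; ring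
  -- `t = σt · d`: from `σ(t + β) βd = d + βt` and `σβ β = 1`
  have h3 : β * (σ t * d) = β * t := by linear_combination hU3 - d * hσββ
  exact (mul_left_cancel₀ hβ0 h3).symm

end Unitary

/-! ## §4 The surjection: every norm-one root of `charpoly γ₀` is the `U(1)`-value of an `H`-class transferring to `𝒪_st(γ₀)` -/

section Surjection

variable {L : Type*} [Field L] (σ : L →+* L) {H : Matrix (Fin 3) (Fin 3) L}

/-- **`∃ γ₂ ∈ U(Φ₂)(L^σ)` with `charpoly γ₂ · (X − β) = charpoly γ`** for every `γ ∈ U(σ, H)(L)` (`3 × 3`, `det H ≠ 0`) and every root `β` of `charpoly γ` with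
`β σβ = 1` (§2 at the σ-reciprocal quotient of §3). [cite: Rogawski1990, §3.2 Thm. 3.2.1 p. 20; §5.4 (5.4.5) p. 74] -/
theorem exists_unitaryGroup_antidiagTwo_charpoly_mul_X_sub_C_eq (hσσ : ∀ x, σ (σ x) = x) (hσ : ∃ z, σ z ≠ z) (hH : H.det ≠ 0)
    (γ : unitaryGroup σ H) {β : L} (hβ : (((γ : GL (Fin 3) L) : Matrix (Fin 3) (Fin 3) L).charpoly).IsRoot β) (hβ1 : β * σ β = 1) :
    ∃ γ₂ : unitaryGroup σ (Matrix.of fun i j : Fin 2 => if i.val + j.val + 1 = 2 then (1 : L) else 0),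
      ((γ₂ : GL (Fin 2) L) : Matrix (Fin 2) (Fin 2) L).charpoly * (X - C β) = ((γ : GL (Fin 3) L) : Matrix (Fin 3) (Fin 3) L).charpoly := by
  obtain ⟨t, d, hd, ht, hp⟩ := exists_charpoly_eq_X_sub_C_mul_of_isRoot hH γ hβ hβ1
  obtain ⟨γ₂, hγ₂⟩ := exists_unitaryGroup_antidiagTwo_charpoly_eq σ hσσ hσ hd ht
  exact ⟨γ₂, by rw [hγ₂, hp, mul_comm]⟩

/-- The scalar `(β) ∈ U(Φ₁)(L^σ) = U(1)` for `β σβ = 1`. [cite: Rogawski1990, §3.5 p. 29] -/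
theorem exists_unitaryGroup_antidiagOne_apply_eq {β : L} (hβ1 : β * σ β = 1) :
    ∃ γ₁ : unitaryGroup σ (Matrix.of fun i j : Fin 1 => if i.val + j.val + 1 = 1 then (1 : L) else 0),
      ((γ₁ : GL (Fin 1) L) : Matrix (Fin 1) (Fin 1) L) 0 0 = β := by
  have hβ0 : β ≠ 0 := left_ne_zero_of_mul_eq_one hβ1
  have hdet : (!![β] : Matrix (Fin 1) (Fin 1) L).det ≠ 0 := by rwa [Matrix.det_fin_one_of]
  refine ⟨⟨Matrix.GeneralLinearGroup.mkOfDetNeZero _ hdet, ?_⟩, rfl⟩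
  change ((!![β] : Matrix (Fin 1) (Fin 1) L).map σ)ᵀ * (Matrix.of fun i j : Fin 1 => if i.val + j.val + 1 = 1 then (1 : L) else 0) * !![β] =
    Matrix.of fun i j : Fin 1 => if i.val + j.val + 1 = 1 then (1 : L) else 0
  ext i j
  fin_cases i; fin_cases j
  simp [Matrix.mul_apply]
  rw [mul_comm]; exact hβ1

/-- **THE SURJECTION (rank-2 Kottwitz–Steinberg input of the (5.4.5) bijection).**  For `γ ∈ U(σ, H)(L)` REGULAR (separable characteristic polynomial),
`det H ≠ 0`, `σ` a non-trivial involution, and every root `β ∈ L` of `charpoly γ` with `β σβ = 1`, there is a stable class `𝒪H` of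
`H = U(Φ₂) × U(Φ₁)` TRANSFERRING to `𝒪_st(γ)` (★ `StableClassH.TransfersTo`, target form `H` itself) with `U(1)`-value `sndVal 𝒪H = β`: the class of
`(γ₂, (β))` with `charpoly γ₂ · (X − β) = charpoly γ` (§4), since `charpoly ι(γ₂, (β)) = charpoly γ` (★ `charpoly_endoEmb`) and equal SEPARABLE characteristic
polynomials force `GL₃`-conjugacy (★ `isConj_of_charpoly_eq_of_separable`).  Together with ★ `StableClassH.injOn_sndVal_setOf_transfersTo` this makes
`sndVal : {𝒪H ↦ 𝒪_st(γ)} → {β : charpoly γ (β) = 0, β σβ = 1}` a BIJECTION («`3 ∕ 1 ∕ 0` classes of `H` transfer to `𝒪_st`»).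
[cite: Rogawski1990, §5.4 (5.4.5) pp. 72–74] [cite: Rogawski1990, §3.2 Thm. 3.2.1 p. 20] -/
theorem exists_stableClassH_transfersTo_and_sndVal_eq (hσσ : ∀ x, σ (σ x) = x) (hσ : ∃ z, σ z ≠ z) (hH : H.det ≠ 0)
    (γ : unitaryGroup σ H) (hreg : IsRegularElt (γ : GL (Fin 3) L)) {β : L}
    (hβ : (((γ : GL (Fin 3) L) : Matrix (Fin 3) (Fin 3) L).charpoly).IsRoot β) (hβ1 : β * σ β = 1) :
    ∃ 𝒪H : StableClassH σ (Matrix.of fun i j : Fin 2 => if i.val + j.val + 1 = 2 then (1 : L) else 0)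
        (Matrix.of fun i j : Fin 1 => if i.val + j.val + 1 = 1 then (1 : L) else 0),
      𝒪H.TransfersTo H endoForm_antidiagOne (stableClassOf σ H γ) ∧ 𝒪H.sndVal = β := by
  obtain ⟨γ₂, hγ₂⟩ := exists_unitaryGroup_antidiagTwo_charpoly_mul_X_sub_C_eq σ hσσ hσ hH γ hβ hβ1
  obtain ⟨γ₁, hγ₁⟩ := exists_unitaryGroup_antidiagOne_apply_eq σ hβ1
  refine ⟨stableClassHOf σ _ _ (γ₂, γ₁), ?_, by rw [StableClassH.sndVal_stableClassHOf, hγ₁]⟩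
  rw [StableClassH.transfersTo_mk_iff]
  -- `EndoMatches` = `GL₃`-conjugacy of `ι(γ₂, γ₁)` with `γ`
  have hchar : (((endoEmb σ _ _ _ endoForm_antidiagOne (γ₂, γ₁) : unitaryGroup σ _) : GL (Fin 3) L) : Matrix (Fin 3) (Fin 3) L).charpoly =
      ((γ : GL (Fin 3) L) : Matrix (Fin 3) (Fin 3) L).charpoly := by
    rw [charpoly_endoEmb, hγ₁, hγ₂]
  have hsep : ((((endoEmb σ _ _ _ endoForm_antidiagOne (γ₂, γ₁) : unitaryGroup σ _) : GL (Fin 3) L) : Matrix (Fin 3) (Fin 3) L).charpoly).Separable := by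
    rw [hchar]; exact hreg
  exact isConj_of_charpoly_eq_of_separable _ _ hsep hchar

end Surjection

/-! ## §5 The CM dress: `σ = c` the complex conjugation of a CM field (a non-trivial involution) -/

section CM

open NumberField Literature.NumberTheory.Automorphic

variable (L : Type) [Field L] [NumberField L] [IsCMField L] {H : Matrix (Fin 3) (Fin 3) L}

/-- Complex conjugation of a CM field moves some element. [cite: Rogawski1990, §3.5 p. 29] -/
theorem exists_cmConjRingHom_apply_ne : ∃ z : L, cmConjRingHom L z ≠ z := by
  by_contra h
  apply IsCMField.complexConj_ne_one (K := L)
  ext z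
  by_contra hz
  exact h ⟨z, fun e => hz (by rw [cmConjRingHom_apply] at e; rw [e, AlgEquiv.one_apply])⟩

/-- **(KS-2a) over a CM field**: for `γ ∈ U(H)(L⁺)` regular (`H ∈ M₃(L)` with `det H ≠ 0`) and every root `β ∈ L` of `charpoly γ` with `β β̄ = 1`, some
stable class `𝒪H` of `H(L⁺) = U(Φ₂)(L⁺) × U(Φ₁)(L⁺)` transfers to `𝒪_st(γ)` with `sndVal 𝒪H = β`. [cite: Rogawski1990, §5.4 (5.4.5) pp. 72–74]
[cite: Rogawski1990, §3.2 Thm. 3.2.1 p. 20] -/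
theorem exists_stableClassH_transfersTo_and_sndVal_eq_cm (hH : H.det ≠ 0)
    (γ : unitaryGroup (cmConjRingHom L) H) (hreg : IsRegularElt (γ : GL (Fin 3) L)) {β : L}
    (hβ : (((γ : GL (Fin 3) L) : Matrix (Fin 3) (Fin 3) L).charpoly).IsRoot β) (hβ1 : β * cmConjRingHom L β = 1) :
    ∃ 𝒪H : StableClassH (cmConjRingHom L) (Matrix.of fun i j : Fin 2 => if i.val + j.val + 1 = 2 then (1 : L) else 0)
        (Matrix.of fun i j : Fin 1 => if i.val + j.val + 1 = 1 then (1 : L) else 0),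
      𝒪H.TransfersTo H endoForm_antidiagOne (stableClassOf (cmConjRingHom L) H γ) ∧ 𝒪H.sndVal = β :=
  exists_stableClassH_transfersTo_and_sndVal_eq (cmConjRingHom L) (IsCMField.complexConj_apply_apply L) (exists_cmConjRingHom_apply_ne L) hH γ hreg hβ hβ1

/-- **(KS-2a) over a CM field, element form**: `∃ γ₂ ∈ U(Φ₂)(L⁺)` with `charpoly γ₂ · (X − β) = charpoly γ`. [cite: Rogawski1990, §3.2 Thm. 3.2.1 p. 20] -/
theorem exists_unitaryGroup_antidiagTwo_charpoly_mul_X_sub_C_eq_cm (hH : H.det ≠ 0)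
    (γ : unitaryGroup (cmConjRingHom L) H) {β : L}
    (hβ : (((γ : GL (Fin 3) L) : Matrix (Fin 3) (Fin 3) L).charpoly).IsRoot β) (hβ1 : β * cmConjRingHom L β = 1) :
    ∃ γ₂ : unitaryGroup (cmConjRingHom L) (Matrix.of fun i j : Fin 2 => if i.val + j.val + 1 = 2 then (1 : L) else 0),
      ((γ₂ : GL (Fin 2) L) : Matrix (Fin 2) (Fin 2) L).charpoly * (X - C β) = ((γ : GL (Fin 3) L) : Matrix (Fin 3) (Fin 3) L).charpoly :=
  exists_unitaryGroup_antidiagTwo_charpoly_mul_X_sub_C_eq (cmConjRingHom L) (IsCMField.complexConj_apply_apply L) (exists_cmConjRingHom_apply_ne L) hH γ hβ hβ1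

end CM

end Literature.NumberTheory.Rogawski1990

end
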